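import Mathlib.NumberTheory.ModularForms.DedekindEta
import Literature.NumberTheory.ModularForms.DedekindSumRademacherPhi
import HarnessLib

/-!
# Dedekind's transformation law of `log η` (the LOGARITHMIC form) — named fact

Topic `Literature/NumberTheory/ModularForms`; namespace `Literature.NumberTheory.ModularForms`.
ONE named fact (D-0014, `def … : Prop`; users take `(h : dedekindEta_logTransformationLaw)`), no proof claimed.

The tree PROVES the EXPONENTIATED transformation law of the Dedekind eta function under every `γ ∈ SL₂(ℤ)` with
Rademacher's multiplier (`Literature.NumberTheory.ModularForms.eta_SL2_smul_rademacherPhi`,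
`η(γτ) = e^{πi(Φ(γ)−3)/12} √(cτ+d) η(τ)`, `c > 0`; `EtaMultiplierRademacherPhi.lean`).  Dedekind's theorem is finer: it is a
statement about a holomorphic LOGARITHM of `η` — Rademacher–Grosswald, *Dedekind Sums*, Ch. 4 A, eq. (57a) `log η(τ + b) =
log η(τ) + πib/12` and eq. (60) `log η((aτ+b)/(cτ+d)) = log η(τ) + ½ log((cτ+d)/i) + πiΦ(a b; c d)/12` for `c > 0`, with
`Φ = rademacherPhi` (eq. (59)) and `½ log((cτ+d)/i) = ½ Log(cτ+d) − 3πi/12` (principal `Log`, `cτ + d ∈ ℍ`); Apostol, Thm. 3.4,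
is the same statement with `πi((a+d)/(12c) − s(d,c)) = πiΦ/12`.  Exponentiating loses exactly the sign needed to transform
SQUARE ROOTS of `η`-quotients (odd powers of `η^{1/2}`), which is what the consumer — the kummer line of crux `StarGO2Sigma`
(stmt-BirchSwinnertonDyer-27046), stub K-D `stub_dedekindEtaLog` / K-U `stub_etaSqrt`, planner p2 GEN 38's
`KEta.EtaSign.etaSignCharacter` — needs.  VERBATIM the hypothesis `DedekindLogEtaLaw` of that file.

Rendering: an existential over the branch (`∃ logEta : ℂ → ℂ`, holomorphic on `{Im z > 0}`, `exp ∘ logEta = η` there,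
the `T`-law for integer shifts, the `c > 0` law with the principal logarithm of `cz + d`).  The intended (classical) witness is
`log η(z) = πiz/12 + Σ_{n≥1} log(1 − e^{2πinz})`; the discharge route is Rademacher–Grosswald's induction over `S`, `T` with the
composition law (62) (tree: `RademacherPhiCompositionProofs`) or Siegel's proof of the `S`-case plus Euclid.

## References
* H. Rademacher, E. Grosswald, *Dedekind Sums*, Carus Math. Monographs 16 (1972), Ch. 4 A, eq. (57a), (59), (60).
  [RademacherGrosswald1972]
* T. M. Apostol, *Modular Functions and Dirichlet Series in Number Theory*, GTM 41, 2nd ed. (1990), Thm. 3.4. [Apostol1990]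
-/

noncomputable section

namespace Literature.NumberTheory.ModularForms

/-- **Dedekind's transformation law of `log η` (logarithmic form; Rademacher–Grosswald Ch. 4 A eq. (57a), (60) = Apostol
Thm. 3.4).**  There is a holomorphic branch `log η` on `{Im z > 0}` with `exp(log η(z)) = η(z)`,
`log η(z + b) = log η(z) + πi b/12` for `b ∈ ℤ`, and, for `ad − bc = 1` with `c > 0`,
`log η((az+b)/(cz+d)) = log η(z) + ½ Log(cz+d) + πi (Φ(a b; c d) − 3)/12` (principal `Log`; `Φ = rademacherPhi`).
Named fact (D-0014), not proved in the tree; the tree's `eta_SL2_smul_rademacherPhi` is its exponentiation.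
[cite: RademacherGrosswald1972, Ch. 4 A, eq. (57a) and (60)] [cite: Apostol1990, Thm. 3.4] -/
def dedekindEta_logTransformationLaw : Prop :=
  ∃ logEta : ℂ → ℂ, DifferentiableOn ℂ logEta {z : ℂ | 0 < z.im} ∧
    (∀ z : ℂ, 0 < z.im → Complex.exp (logEta z) = ModularForm.eta z) ∧
    (∀ z : ℂ, 0 < z.im → ∀ b : ℤ, logEta (z + b) = logEta z + Real.pi * Complex.I * b / 12) ∧
    (∀ a b c d : ℤ, a * d - b * c = 1 → 0 < c → ∀ z : ℂ, 0 < z.im →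
      logEta ((a * z + b) / (c * z + d)) =
        logEta z + Complex.log (c * z + d) / 2 + Real.pi * Complex.I * (((rademacherPhi a b c d : ℚ) : ℂ) - 3) / 12)

end Literature.NumberTheory.ModularForms

end
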